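import Summits.AtomisticToContinuum.Crystallization.Theorems.ChessboardParticlePlanesPeriodicWindowsShapeStationarity1
import Summits.AtomisticToContinuum.Crystallization.Theorems.ExcessDecayLiouvilleFarField
import Summits.AtomisticToContinuum.Crystallization.Theorems.PhononSlackCertificatesPeriodicGivenLayeredLayerCake3

/-!
# Crux `PeriodicWindows` (stmt-AtomisticToContinuum-3240), line `Sketch` — stub E2a, part 2: site sums of a Barlow stacking

Helper file for the registered stub `stub_shapeStationarity` (E2a) of the lead skeleton `PeriodicWindowsSketch`
(rev 9). For a rotated Barlow stacking `S = A '' barlowStacking a h s` (`a, h > 0`, ANY label sequence `s`, so in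
particular any Hägg sequence) and a pair function `V`:

* `shp_summable_inv_pow_index`, `shp_summable_lennardJones_index` — the families
  `t ↦ |x₀ − barlowPos t|^{-(k+3)}` (`k ≥ 1`) and `t ↦ V_LJ |x₀ − barlowPos t|` on the index set `ℤ³` are summable
  (dyadic packing bound `ExcessDecayLiouville.sum_inv_pow_le_of_separated`);
* `shp_site_tsum_eq` — **the site sum is twice `barlowSiteEnergy`**: for `V 0 = 0` and a summable index family,
  `∑'_{q ∈ S, q ≠ p} V |p − q| = 2 · barlowSiteEnergy V a h s m` for every point `p` of layer `m`
  (re-indexing by `ℤ³`, in-layer translation, slicing `ℤ³ = ℤ × ℤ²`, splitting `ℤ` at `m`);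
* `shp_barlowSiteEnergy_linear`, `shp_barlowSiteEnergy_smul` — linearity of `barlowSiteEnergy` in `V` (under
  summability) and the scaling `barlowSiteEnergy Vₙ a (a c) s m = (a²)⁻ⁿ barlowSiteEnergy Vₙ 1 c s m` for
  `Vₙ r = (r²)⁻ⁿ`.

All `[folklore]`.
-/

noncomputable section

namespace Summit.AtomisticToContinuum.Crystallization.Theorems.PeriodicWindowsSketch

open Literature.MathematicalPhysics.StatisticalMechanics
open Summit.AtomisticToContinuum.Crystallization.Theorems.ExcessDecayLiouville (sum_inv_pow_le_of_separated)

/-! ## Summability on the index set -/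

/-- **Packing bound on the index set.** For `a, h > 0`, `k ≥ 1`, a base index `t₀` and a finite set of indices `T`:
`∑_{t ∈ T} |barlowPos t₀ − barlowPos t|^{-(k+3)} ≤ 1024 / (δ³ δᵏ)`, `δ = min a h` (the term at `t₀` is `0`).
[folklore] -/
theorem shp_sum_inv_pow_index_le {a h : ℝ} (ha : 0 < a) (hh : 0 < h) (s : ℤ → ℤ) (t₀ : ℤ × ℤ × ℤ) {k : ℕ}
    (hk : 1 ≤ k) (T : Finset (ℤ × ℤ × ℤ)) :
    ∑ t ∈ T, (dist (barlowPos a h s t₀.1 t₀.2.1 t₀.2.2) (barlowPos a h s t.1 t.2.1 t.2.2))⁻¹ ^ (k + 3) ≤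
      1024 / ((min a h) ^ 3 * (min a h) ^ k) := by
  classical
  set δ : ℝ := min a h with hδ
  have hδ0 : 0 < δ := lt_min ha hh
  set P : ℤ × ℤ × ℤ → EuclideanSpace ℝ (Fin 3) := fun t => barlowPos a h s t.1 t.2.1 t.2.2 with hP
  have hPinj : Function.Injective P := by
    have := shp_param_injective ha hh s (LinearIsometry.id : EuclideanSpace ℝ (Fin 3) →ₗᵢ[ℝ]
      EuclideanSpace ℝ (Fin 3))
    simpa [hP] using this
  set f : ℤ × ℤ × ℤ → ℝ := fun t => (dist (P t₀) (P t))⁻¹ ^ (k + 3) with hf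
  have hf0 : f t₀ = 0 := by
    simp only [hf, dist_self, inv_zero]
    exact zero_pow (by omega)
  -- drop `t₀` and pass to the image in `ℝ³`
  have hsum : ∑ t ∈ T, f t = ∑ t ∈ T.erase t₀, f t := (Finset.sum_erase T hf0).symm
  set F : Finset (EuclideanSpace ℝ (Fin 3)) := (T.erase t₀).image P with hF
  have hsum2 : ∑ t ∈ T.erase t₀, f t = ∑ q ∈ F, (dist q (P t₀))⁻¹ ^ (k + 3) := by
    rw [hF, Finset.sum_image fun x _ y _ hxy => hPinj hxy]
    refine Finset.sum_congr rfl fun t _ => ?_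
    rw [hf, dist_comm]
  have hsep : ∀ q ∈ F, ∀ q' ∈ F, q ≠ q' → δ ≤ dist q q' := by
    intro q hq q' hq' hne
    simp only [hF, Finset.mem_image] at hq hq'
    obtain ⟨t, -, rfl⟩ := hq
    obtain ⟨t', -, rfl⟩ := hq'
    exact le_dist_of_mem_barlowStacking a h s ha.le hh.le (barlowPos_mem _ _ _) (barlowPos_mem _ _ _)
      hne
  have hfar : ∀ q ∈ F, δ ≤ dist q (P t₀) := by
    intro q hq
    simp only [hF, Finset.mem_image, Finset.mem_erase] at hq
    obtain ⟨t, ⟨htne, -⟩, rfl⟩ := hq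
    have hne : P t ≠ P t₀ := fun h' => htne (hPinj h')
    exact le_dist_of_mem_barlowStacking a h s ha.le hh.le (barlowPos_mem _ _ _) (barlowPos_mem _ _ _)
      hne
  have key := sum_inv_pow_le_of_separated F (P t₀) hk hδ0 le_rfl hsep hfar
  calc ∑ t ∈ T, (dist (barlowPos a h s t₀.1 t₀.2.1 t₀.2.2) (barlowPos a h s t.1 t.2.1 t.2.2))⁻¹ ^ (k + 3)
      = ∑ t ∈ T, f t := rfl
    _ = ∑ q ∈ F, (dist q (P t₀))⁻¹ ^ (k + 3) := by rw [hsum, hsum2]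
    _ ≤ 1024 / (δ ^ 3 * δ ^ k) := key

/-- **Summability of inverse powers on the index set**: `t ↦ |barlowPos t₀ − barlowPos t|^{-(k+3)}` is summable
over `ℤ³` for `k ≥ 1` (`a, h > 0`). [folklore] -/
theorem shp_summable_inv_pow_index {a h : ℝ} (ha : 0 < a) (hh : 0 < h) (s : ℤ → ℤ) (t₀ : ℤ × ℤ × ℤ) {k : ℕ}
    (hk : 1 ≤ k) :
    Summable fun t : ℤ × ℤ × ℤ =>
      (dist (barlowPos a h s t₀.1 t₀.2.1 t₀.2.2) (barlowPos a h s t.1 t.2.1 t.2.2))⁻¹ ^ (k + 3) :=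
  summable_of_sum_le (fun _ => by positivity) (shp_sum_inv_pow_index_le ha hh s t₀ hk)

/-- `|V_LJ(r)| ≤ (1/12) r⁻¹² + (1/6) r⁻⁶` for every real `r`. [folklore] -/
theorem shp_abs_lennardJones_le (r : ℝ) :
    |lennardJones r| ≤ (1 / 12) * (r⁻¹) ^ (9 + 3) + (1 / 6) * (r⁻¹) ^ (3 + 3) := by
  unfold lennardJones
  have h1 : 0 ≤ (1 / 12) * (r⁻¹) ^ 12 := by positivity
  have h2 : 0 ≤ (1 / 6) * (r⁻¹) ^ 6 := by positivity
  calc |(1 / 12) * (r⁻¹) ^ 12 - (1 / 6) * (r⁻¹) ^ 6|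
      ≤ |(1 / 12) * (r⁻¹) ^ 12| + |(1 / 6) * (r⁻¹) ^ 6| := abs_sub _ _
    _ = (1 / 12) * (r⁻¹) ^ (9 + 3) + (1 / 6) * (r⁻¹) ^ (3 + 3) := by
        rw [abs_of_nonneg h1, abs_of_nonneg h2]

/-- **Summability of the Lennard-Jones terms on the index set.** [folklore] -/
theorem shp_summable_lennardJones_index {a h : ℝ} (ha : 0 < a) (hh : 0 < h) (s : ℤ → ℤ) (t₀ : ℤ × ℤ × ℤ) :
    Summable fun t : ℤ × ℤ × ℤ =>
      lennardJones (dist (barlowPos a h s t₀.1 t₀.2.1 t₀.2.2) (barlowPos a h s t.1 t.2.1 t.2.2)) := by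
  refine Summable.of_norm_bounded (((shp_summable_inv_pow_index ha hh s t₀ (k := 9) (by norm_num)).mul_left
    (1 / 12)).add ((shp_summable_inv_pow_index ha hh s t₀ (k := 3) (by norm_num)).mul_left (1 / 6))) fun t => ?_
  rw [Real.norm_eq_abs]
  exact shp_abs_lennardJones_le _

/-! ## Slicing the index set -/

/-- In-layer translation: distances from `barlowPos m i₀ j₀` are distances from the base point `barlowPos m 0 0` after
the shift `(i, j) ↦ (i − i₀, j − j₀)`. [folklore] -/
theorem shp_dist_shift (a h : ℝ) (s : ℤ → ℤ) (m i₀ j₀ k i j : ℤ) :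
    dist (barlowPos a h s m i₀ j₀) (barlowPos a h s k (i + i₀) (j + j₀)) =
      dist (barlowPos a h s m 0 0) (barlowPos a h s k i j) := by
  rw [dist_barlowPos_eq_norm_layerVec, dist_barlowPos_eq_norm_layerVec, add_sub_cancel_right,
    add_sub_cancel_right, sub_zero, sub_zero]

/-- **`barlowSiteEnergy` as one sum over the index set**: for `V 0 = 0` and a summable index family from the base
point of layer `m`, `2 · barlowSiteEnergy V a h s m = ∑'_{t ∈ ℤ³} V |barlowPos m 0 0 − barlowPos t|` (slice
`ℤ³ = ℤ × ℤ²`, split `ℤ` at `m`; the term `t = (m,0,0)` vanishes). [folklore] -/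
theorem shp_two_mul_barlowSiteEnergy_eq_tsum {a h : ℝ} (s : ℤ → ℤ) (V : ℝ → ℝ) (hV0 : V 0 = 0) (m : ℤ)
    (hG : Summable fun t : ℤ × ℤ × ℤ => V (dist (barlowPos a h s m 0 0) (barlowPos a h s t.1 t.2.1 t.2.2))) :
    2 * barlowSiteEnergy V a h s m =
      ∑' t : ℤ × ℤ × ℤ, V (dist (barlowPos a h s m 0 0) (barlowPos a h s t.1 t.2.1 t.2.2)) := by
  set g : ℤ → ℝ := fun k => ∑' ij : ℤ × ℤ, V (dist (barlowPos a h s m 0 0) (barlowPos a h s k ij.1 ij.2)) with hg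
  -- slice `ℤ³ = ℤ × ℤ²`
  have step3 : ∑' t : ℤ × ℤ × ℤ, V (dist (barlowPos a h s m 0 0) (barlowPos a h s t.1 t.2.1 t.2.2)) = ∑' k, g k :=
    hG.tsum_prod
  -- split `ℤ` at `m`
  have hgsum : Summable g := hG.prod
  have hshift : ∑' k, g k = ∑' n : ℤ, g (m + n) := ((Equiv.addLeft m).tsum_eq g).symm
  have hf₁ : Summable fun n : ℕ => g (m + ((n : ℤ) + 1)) :=
    hgsum.comp_injective (i := fun n : ℕ => m + ((n : ℤ) + 1)) fun x y hxy => by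
      simpa using hxy
  have hf₂ : Summable fun n : ℕ => g (m + -((n : ℤ) + 1)) :=
    hgsum.comp_injective (i := fun n : ℕ => m + -((n : ℤ) + 1)) fun x y hxy => by
      have : (x : ℤ) = y := by linarith
      exact_mod_cast this
  have step4 : ∑' n : ℤ, g (m + n) =
      (∑' n : ℕ, g (m + ((n : ℤ) + 1))) + g (m + 0) + ∑' n : ℕ, g (m + -((n : ℤ) + 1)) :=
    tsum_of_add_one_of_neg_add_one (f := fun n : ℤ => g (m + n)) hf₁ hf₂
  -- identify the three pieces of `barlowSiteEnergy`
  have hX : g (m + 0) = ∑' ij : ℤ × ℤ, (if ij = 0 then 0 else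
      V (dist (barlowPos a h s m 0 0) (barlowPos a h s m ij.1 ij.2))) := by
    rw [add_zero, hg]
    refine tsum_congr fun ij => ?_
    by_cases hij : ij = 0
    · subst hij
      simp [hV0]
    · rw [if_neg hij]
  have hY : ∑' n : ℕ, g (m + ((n : ℤ) + 1)) = ∑' n : ℕ, ∑' ij : ℤ × ℤ,
      V (dist (barlowPos a h s m 0 0) (barlowPos a h s (m + (n + 1 : ℕ)) ij.1 ij.2)) := by
    refine tsum_congr fun n => ?_
    rw [hg]
    push_cast
    rfl
  have hZ : ∑' n : ℕ, g (m + -((n : ℤ) + 1)) = ∑' n : ℕ, ∑' ij : ℤ × ℤ,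
      V (dist (barlowPos a h s m 0 0) (barlowPos a h s (m - (n + 1 : ℕ)) ij.1 ij.2)) := by
    refine tsum_congr fun n => ?_
    rw [hg, ← sub_eq_add_neg]
    push_cast
    rfl
  rw [step3, hshift, step4, hX, hY, hZ, barlowSiteEnergy]
  ring

/-- **The site sum is twice `barlowSiteEnergy`.** For `a, h > 0`, a linear isometry `A`, a pair function `V` with
`V 0 = 0` whose index family from the base point of layer `m` is summable, and ANY point `p = A (barlowPos m i₀ j₀)`
of layer `m`: `∑'_{q ∈ A(stacking), q ≠ p} V |p − q| = 2 · barlowSiteEnergy V a h s m`. [folklore] -/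
theorem shp_site_tsum_eq {a h : ℝ} (ha : 0 < a) (hh : 0 < h) (s : ℤ → ℤ)
    (A : EuclideanSpace ℝ (Fin 3) →ₗᵢ[ℝ] EuclideanSpace ℝ (Fin 3)) (V : ℝ → ℝ) (hV0 : V 0 = 0) (m i₀ j₀ : ℤ)
    (hG : Summable fun t : ℤ × ℤ × ℤ => V (dist (barlowPos a h s m 0 0) (barlowPos a h s t.1 t.2.1 t.2.2))) :
    ∑' q : {q : EuclideanSpace ℝ (Fin 3) // q ∈ A '' barlowStacking a h s ∧ q ≠ A (barlowPos a h s m i₀ j₀)},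
        V (dist (A (barlowPos a h s m i₀ j₀)) (q : EuclideanSpace ℝ (Fin 3))) =
      2 * barlowSiteEnergy V a h s m := by
  -- the parametrisation
  set e : ℤ × ℤ × ℤ → EuclideanSpace ℝ (Fin 3) := fun t => A (barlowPos a h s t.1 t.2.1 t.2.2) with he
  have hinj : Function.Injective e := shp_param_injective ha hh s A
  have hS : A '' barlowStacking a h s = Set.range e := (shp_range_param a h s A).symm
  have hp : A (barlowPos a h s m i₀ j₀) = e (m, i₀, j₀) := rfl
  -- Step 1: drop the constraint `q ≠ p` (the term vanishes) and pass to the index set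
  have h0 : V (dist (e (m, i₀, j₀)) (e (m, i₀, j₀))) = 0 := by rw [dist_self, hV0]
  have step1 : ∑' q : {q : EuclideanSpace ℝ (Fin 3) // q ∈ A '' barlowStacking a h s ∧ q ≠ A (barlowPos a h s m i₀ j₀)},
      V (dist (A (barlowPos a h s m i₀ j₀)) (q : EuclideanSpace ℝ (Fin 3))) =
        ∑' t : ℤ × ℤ × ℤ, V (dist (e (m, i₀, j₀)) (e t)) := by
    rw [hp, hS, LayeredHull.cake_tsum_subtype_ne_eq (fun q => V (dist (e (m, i₀, j₀)) q)) _ _ h0]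
    exact tsum_range (fun q => V (dist (e (m, i₀, j₀)) q)) hinj
  -- Step 2: in-layer translation to the base point
  set σ : ℤ × ℤ × ℤ ≃ ℤ × ℤ × ℤ :=
    (Equiv.refl ℤ).prodCongr ((Equiv.addRight i₀).prodCongr (Equiv.addRight j₀)) with hσ
  have step2 : ∑' t : ℤ × ℤ × ℤ, V (dist (e (m, i₀, j₀)) (e t)) =
      ∑' t : ℤ × ℤ × ℤ, V (dist (barlowPos a h s m 0 0) (barlowPos a h s t.1 t.2.1 t.2.2)) := by
    rw [← Equiv.tsum_eq σ]
    refine tsum_congr fun t => ?_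
    obtain ⟨k, i, j⟩ := t
    simp only [hσ, Equiv.prodCongr_apply, Equiv.coe_refl, Prod.map_apply, id_eq, Equiv.coe_addRight, he,
      LinearIsometry.dist_map]
    rw [shp_dist_shift]
  rw [step1, step2, shp_two_mul_barlowSiteEnergy_eq_tsum s V hV0 m hG]

end Summit.AtomisticToContinuum.Crystallization.Theorems.PeriodicWindowsSketch

end
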